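import Mathlib

/-!
# Celestial cocircularity and circle confinement — the certificate half of the OCTAGON ONSET THEOREM (plan-lens-HodgeAV-embed g9)

HONEST FRAMING. Crux workfile for `…Theses.EightfoldBlochSeeds.BlochSeedDiscOne` (stmt-HodgeConjecture-18881; skeleton `Lines/birth.lean`
814a6a70c14e831a, `stub_rung_pad4_seedAt` UNTOUCHED, OPEN). MINT E4 «change the CM» (director-hodge g20). Companion memo:
`OCTAGON-ONSET-THEOREM-embed-g9.md`. NOTHING HERE SAYS THAT HC ∕ HC_CM ∕ HC_AV ∕ №4 ∕ 26512 ∕ 18881 ∕ H2 HOLDS OR FAILS; no rung is claimed;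
this is evidence about g6's CELESTIAL LAW (a certificate strategy against two-term corank ≤ 4 designs), kernel-checked in its own finite model.

THE MODEL (g6 `CELESTIAL-PHASE-LAW-embed-g6.md` §3 MASTER CRITERION, g8 `diaglp3.py`, round-sphere normalisation δ = 1). A finite set `s` of atoms
(the LINE-n null co-letter rays), real coordinates `d g b : ι → ℝ` (ray ↦ (d̂, ĝ, b̂) on the sphere; the sphere equation is NOT used below), weights
`ν : ι → ℝ` (the reduced residual measure: `w` on the residual rays U, `−t ≤ 0` elsewhere), and the Weil charge `μ = μre + i·μim = E_ν[β̂⁴]`,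
`β̂ = ĝ + i b̂`. `CleanMoments s ν d g b μre μim` is LITERALLY the constraint block of the reduced diagonal LP: all 35 monomial moments
`Σ ν·d^i g^j b^k` (i+j+k ≤ 4) vanish except the five pure-(g,b) quartics, which take the values τ(μ) = (μre/8, μim/8, −μre/8, −μim/8, μre/8) at
(j,k) = (4,0),(3,1),(2,2),(1,3),(0,4). (g8's δ-frames, β̂ = p_g + i√δ p_b, μ = μre + i√δ μim′, are this system after the real rescaling
b := √δ·p_b, μim := √δ·μim′ — an invertible change of the data, so feasibility and «μ = 0» are unchanged; the latitude coordinate d may be taken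
unscaled since only the conditions `d = const` and moments in d enter.)

WHAT IS PROVED (sorry-free, axiom-free beyond Mathlib's, no instance, no notation):
* `sum_biquadratic_expand`, `pairing_identity` — for affine test functions ℓ₁, ℓ₂ (ℓ = α + p d + q g + r b),
  `Σ ν·ℓ₁²ℓ₂² = (P·μre + Q·μim)/8`, `P − iQ = (q₁ − i r₁)²(q₂ − i r₂)²`: the certificate pairs only with the (4,±4) harmonic = the charge.
* `pairing_nonpos` — if the positive atoms lie in {x₁,x₂,x₃,x₄}, ℓ₁ vanishes at x₁,x₂ and ℓ₂ at x₃,x₄, then `Σ ν·ℓ₁²ℓ₂² ≤ 0`.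
* `weil_charge_zero_of_two_latitudes` — THEOREM 1 (cocircularity): positive support ⊆ {x₁,x₂,x₃,x₄} and `d x₁ ≠ d x₂` ⇒ μ = 0.
  `cocircular_of_charge_ne_zero` — hence μ ≠ 0 forces the four residual rays onto ONE latitude circle d = d x₁.
* `weil_charge_zero_of_three_atoms` — COROLLARY (corank ≤ 3): positive support ⊆ {x₁,x₂,x₃} ⇒ μ = 0, at every height in every frame.
* `negative_support_on_circle` — THEOREM 2 (confinement, certificate (d − a)²): if the positive atoms have d = a then so does every negative atom.
* `bad_measure_lives_on_one_circle` — both together: a bad reduced measure (μ ≠ 0, ≤ 4 positive atoms) is supported on a single latitude circle.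
* `CleanMomentsDelta`, `cleanMoments_of_delta`, `…_delta` — the same statements in g8's δ-conventions (β̂ = p_g + i√δ p_b; δ = 1, 3, m).
NOT certified here (pen, memo §3): the counting step on the circle (Fourier modes 0–3 vanish ⇒ ≥ 8 rays, 4 positive + ≥ 4 negative; existence and
forcedness of μ on an 8-ray circle) and g6's reduction of the full corank-4 law to the diagonal LP (THEOREMS A/B, COVARIANCE).
-/

set_option linter.unusedVariables false
set_option linter.style.longLine false
set_option linter.dupNamespace false
set_option maxHeartbeats 2000000

namespace Summit.HodgeConjecture.HodgeConjecture.Cruxes.BlochSeedDiscOne.CelestialCocircularity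

open Finset

variable {ι : Type*}

/-- monomial moment `Σ_{x ∈ s} ν_x · d_x^i g_x^j b_x^k` of the reduced residual measure. -/
def mom (s : Finset ι) (ν d g b : ι → ℝ) (i j k : ℕ) : ℝ :=
  ∑ x ∈ s, ν x * (d x ^ i * g x ^ j * b x ^ k)

/-- rescaling one coordinate rescales the moments: `mom (c·b) i j k = c^k · mom b i j k`. -/
theorem mom_scale_b (s : Finset ι) (ν d g b : ι → ℝ) (c : ℝ) (i j k : ℕ) :
    mom s ν d g (fun x => c * b x) i j k = c ^ k * mom s ν d g b i j k := by
  simp only [mom, Finset.mul_sum]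
  refine Finset.sum_congr rfl (fun x _ => ?_)
  rw [mul_pow]
  ring

/-- the constraint block of g6's reduced diagonal LP (35 monomials of degree ≤ 4, τ(μ) on the pure-(g,b) quartics; round sphere, δ = 1):
all moments vanish except `m40 = μre/8, m31 = μim/8, m22 = −μre/8, m13 = −μim/8, m04 = μre/8`. (A plain `def … : Prop`, no structure.) -/
def CleanMoments (s : Finset ι) (ν d g b : ι → ℝ) (μre μim : ℝ) : Prop :=
  (∀ i j k : ℕ, i + j + k ≤ 4 → ¬ (i = 0 ∧ j + k = 4) → mom s ν d g b i j k = 0) ∧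
  mom s ν d g b 0 4 0 = μre / 8 ∧ mom s ν d g b 0 3 1 = μim / 8 ∧ mom s ν d g b 0 2 2 = -(μre / 8) ∧
  mom s ν d g b 0 1 3 = -(μim / 8) ∧ mom s ν d g b 0 0 4 = μre / 8

theorem CleanMoments.zero {s : Finset ι} {ν d g b : ι → ℝ} {μre μim : ℝ} (h : CleanMoments s ν d g b μre μim) :
    ∀ i j k : ℕ, i + j + k ≤ 4 → ¬ (i = 0 ∧ j + k = 4) → mom s ν d g b i j k = 0 := h.1
theorem CleanMoments.m40 {s : Finset ι} {ν d g b : ι → ℝ} {μre μim : ℝ} (h : CleanMoments s ν d g b μre μim) :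
    mom s ν d g b 0 4 0 = μre / 8 := h.2.1
theorem CleanMoments.m31 {s : Finset ι} {ν d g b : ι → ℝ} {μre μim : ℝ} (h : CleanMoments s ν d g b μre μim) :
    mom s ν d g b 0 3 1 = μim / 8 := h.2.2.1
theorem CleanMoments.m22 {s : Finset ι} {ν d g b : ι → ℝ} {μre μim : ℝ} (h : CleanMoments s ν d g b μre μim) :
    mom s ν d g b 0 2 2 = -(μre / 8) := h.2.2.2.1
theorem CleanMoments.m13 {s : Finset ι} {ν d g b : ι → ℝ} {μre μim : ℝ} (h : CleanMoments s ν d g b μre μim) :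
    mom s ν d g b 0 1 3 = -(μim / 8) := h.2.2.2.2.1
theorem CleanMoments.m04 {s : Finset ι} {ν d g b : ι → ℝ} {μre μim : ℝ} (h : CleanMoments s ν d g b μre μim) :
    mom s ν d g b 0 0 4 = μre / 8 := h.2.2.2.2.2

/-- g8's δ-frame constraint block (`diaglp3.tau`): `β̂ = p_g + i√δ·p_b`, `μ = μre + i√δ·μim′`, targets
`m40 = μre/8, m31 = μim′/8, m22 = −μre/(8δ), m13 = −μim′/(8δ), m04 = μre/(8δ²)` (δ = Db_coef: 1 for ℚ(i)-type, 3 for ℚ(ω)-type, m for RKm). -/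
def CleanMomentsDelta (s : Finset ι) (ν d g b : ι → ℝ) (δ μre μim : ℝ) : Prop :=
  (∀ i j k : ℕ, i + j + k ≤ 4 → ¬ (i = 0 ∧ j + k = 4) → mom s ν d g b i j k = 0) ∧
  mom s ν d g b 0 4 0 = μre / 8 ∧ mom s ν d g b 0 3 1 = μim / 8 ∧ mom s ν d g b 0 2 2 = -(μre / (8 * δ)) ∧
  mom s ν d g b 0 1 3 = -(μim / (8 * δ)) ∧ mom s ν d g b 0 0 4 = μre / (8 * δ ^ 2)

/-- TRANSPORT: the δ-block is the round-sphere block after the real rescaling `b := √δ·p_b`, `μim := √δ·μim′`. -/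
theorem cleanMoments_of_delta {s : Finset ι} {ν d g b : ι → ℝ} {δ μre μim : ℝ} (hδ : 0 < δ)
    (h : CleanMomentsDelta s ν d g b δ μre μim) :
    CleanMoments s ν d g (fun x => Real.sqrt δ * b x) μre (Real.sqrt δ * μim) := by
  obtain ⟨hz, h40, h31, h22, h13, h04⟩ := h
  have hδ0 : δ ≠ 0 := ne_of_gt hδ
  have h2 : Real.sqrt δ ^ 2 = δ := Real.sq_sqrt hδ.le
  have h3 : Real.sqrt δ ^ 3 = δ * Real.sqrt δ := by
    have e : Real.sqrt δ ^ 3 = Real.sqrt δ ^ 2 * Real.sqrt δ := by ring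
    rw [e, h2]
  have h4 : Real.sqrt δ ^ 4 = δ ^ 2 := by
    have e : Real.sqrt δ ^ 4 = (Real.sqrt δ ^ 2) ^ 2 := by ring
    rw [e, h2]
  refine ⟨fun i j k hijk hq => ?_, ?_, ?_, ?_, ?_, ?_⟩
  · rw [mom_scale_b, hz i j k hijk hq, mul_zero]
  · rw [mom_scale_b, h40]; ring
  · rw [mom_scale_b, h31]; ring
  · rw [mom_scale_b, h22, h2]; field_simp
  · rw [mom_scale_b, h13, h3]; field_simp
  · rw [mom_scale_b, h04, h4]; field_simp

/-- affine test function `ℓ = α + p·d + q·g + r·b` evaluated at the atom `x` (its zero set on the sphere is a circle). -/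
def affine (d g b : ι → ℝ) (α p q r : ℝ) (x : ι) : ℝ := α + p * d x + q * g x + r * b x

theorem affine_apply (d g b : ι → ℝ) (α p q r : ℝ) (x : ι) :
    affine d g b α p q r x = α + p * d x + q * g x + r * b x := rfl

/-- `Σ ν·ℓ₁²ℓ₂²` expanded over the 35 monomial moments (coefficients generated by `gen_pairing.py`, identity checked by `ring`). -/
theorem sum_biquadratic_expand (s : Finset ι) (ν d g b : ι → ℝ) (α₁ p₁ q₁ r₁ α₂ p₂ q₂ r₂ : ℝ) :
    ∑ x ∈ s, ν x * (affine d g b α₁ p₁ q₁ r₁ x ^ 2 * affine d g b α₂ p₂ q₂ r₂ x ^ 2)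
      = (α₁ ^ 2 * α₂ ^ 2) * mom s ν d g b 0 0 0
      + (2 * α₁ ^ 2 * α₂ * r₂ + 2 * α₁ * r₁ * α₂ ^ 2) * mom s ν d g b 0 0 1
      + (2 * α₁ ^ 2 * α₂ * q₂ + 2 * α₁ * q₁ * α₂ ^ 2) * mom s ν d g b 0 1 0
      + (2 * α₁ ^ 2 * α₂ * p₂ + 2 * α₁ * p₁ * α₂ ^ 2) * mom s ν d g b 1 0 0
      + (α₁ ^ 2 * r₂ ^ 2 + 4 * α₁ * r₁ * α₂ * r₂ + r₁ ^ 2 * α₂ ^ 2) * mom s ν d g b 0 0 2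
      + (2 * α₁ ^ 2 * q₂ * r₂ + 4 * α₁ * q₁ * α₂ * r₂ + 4 * α₁ * r₁ * α₂ * q₂ + 2 * q₁ * r₁ * α₂ ^ 2) * mom s ν d g b 0 1 1
      + (α₁ ^ 2 * q₂ ^ 2 + 4 * α₁ * q₁ * α₂ * q₂ + q₁ ^ 2 * α₂ ^ 2) * mom s ν d g b 0 2 0
      + (2 * α₁ ^ 2 * p₂ * r₂ + 4 * α₁ * p₁ * α₂ * r₂ + 4 * α₁ * r₁ * α₂ * p₂ + 2 * p₁ * r₁ * α₂ ^ 2) * mom s ν d g b 1 0 1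
      + (2 * α₁ ^ 2 * p₂ * q₂ + 4 * α₁ * p₁ * α₂ * q₂ + 4 * α₁ * q₁ * α₂ * p₂ + 2 * p₁ * q₁ * α₂ ^ 2) * mom s ν d g b 1 1 0
      + (α₁ ^ 2 * p₂ ^ 2 + 4 * α₁ * p₁ * α₂ * p₂ + p₁ ^ 2 * α₂ ^ 2) * mom s ν d g b 2 0 0
      + (2 * α₁ * r₁ * r₂ ^ 2 + 2 * r₁ ^ 2 * α₂ * r₂) * mom s ν d g b 0 0 3
      + (2 * α₁ * q₁ * r₂ ^ 2 + 4 * α₁ * r₁ * q₂ * r₂ + 4 * q₁ * r₁ * α₂ * r₂ + 2 * r₁ ^ 2 * α₂ * q₂) * mom s ν d g b 0 1 2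
      + (4 * α₁ * q₁ * q₂ * r₂ + 2 * α₁ * r₁ * q₂ ^ 2 + 2 * q₁ ^ 2 * α₂ * r₂ + 4 * q₁ * r₁ * α₂ * q₂) * mom s ν d g b 0 2 1
      + (2 * α₁ * q₁ * q₂ ^ 2 + 2 * q₁ ^ 2 * α₂ * q₂) * mom s ν d g b 0 3 0
      + (2 * α₁ * p₁ * r₂ ^ 2 + 4 * α₁ * r₁ * p₂ * r₂ + 4 * p₁ * r₁ * α₂ * r₂ + 2 * r₁ ^ 2 * α₂ * p₂) * mom s ν d g b 1 0 2
      + (4 * α₁ * p₁ * q₂ * r₂ + 4 * α₁ * q₁ * p₂ * r₂ + 4 * α₁ * r₁ * p₂ * q₂ + 4 * p₁ * q₁ * α₂ * r₂ + 4 * p₁ * r₁ * α₂ * q₂ + 4 * q₁ * r₁ * α₂ * p₂) * mom s ν d g b 1 1 1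
      + (2 * α₁ * p₁ * q₂ ^ 2 + 4 * α₁ * q₁ * p₂ * q₂ + 4 * p₁ * q₁ * α₂ * q₂ + 2 * q₁ ^ 2 * α₂ * p₂) * mom s ν d g b 1 2 0
      + (4 * α₁ * p₁ * p₂ * r₂ + 2 * α₁ * r₁ * p₂ ^ 2 + 2 * p₁ ^ 2 * α₂ * r₂ + 4 * p₁ * r₁ * α₂ * p₂) * mom s ν d g b 2 0 1
      + (4 * α₁ * p₁ * p₂ * q₂ + 2 * α₁ * q₁ * p₂ ^ 2 + 2 * p₁ ^ 2 * α₂ * q₂ + 4 * p₁ * q₁ * α₂ * p₂) * mom s ν d g b 2 1 0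
      + (2 * α₁ * p₁ * p₂ ^ 2 + 2 * p₁ ^ 2 * α₂ * p₂) * mom s ν d g b 3 0 0
      + (r₁ ^ 2 * r₂ ^ 2) * mom s ν d g b 0 0 4
      + (2 * q₁ * r₁ * r₂ ^ 2 + 2 * r₁ ^ 2 * q₂ * r₂) * mom s ν d g b 0 1 3
      + (q₁ ^ 2 * r₂ ^ 2 + 4 * q₁ * r₁ * q₂ * r₂ + r₁ ^ 2 * q₂ ^ 2) * mom s ν d g b 0 2 2
      + (2 * q₁ ^ 2 * q₂ * r₂ + 2 * q₁ * r₁ * q₂ ^ 2) * mom s ν d g b 0 3 1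
      + (q₁ ^ 2 * q₂ ^ 2) * mom s ν d g b 0 4 0
      + (2 * p₁ * r₁ * r₂ ^ 2 + 2 * r₁ ^ 2 * p₂ * r₂) * mom s ν d g b 1 0 3
      + (2 * p₁ * q₁ * r₂ ^ 2 + 4 * p₁ * r₁ * q₂ * r₂ + 4 * q₁ * r₁ * p₂ * r₂ + 2 * r₁ ^ 2 * p₂ * q₂) * mom s ν d g b 1 1 2
      + (4 * p₁ * q₁ * q₂ * r₂ + 2 * p₁ * r₁ * q₂ ^ 2 + 2 * q₁ ^ 2 * p₂ * r₂ + 4 * q₁ * r₁ * p₂ * q₂) * mom s ν d g b 1 2 1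
      + (2 * p₁ * q₁ * q₂ ^ 2 + 2 * q₁ ^ 2 * p₂ * q₂) * mom s ν d g b 1 3 0
      + (p₁ ^ 2 * r₂ ^ 2 + 4 * p₁ * r₁ * p₂ * r₂ + r₁ ^ 2 * p₂ ^ 2) * mom s ν d g b 2 0 2
      + (2 * p₁ ^ 2 * q₂ * r₂ + 4 * p₁ * q₁ * p₂ * r₂ + 4 * p₁ * r₁ * p₂ * q₂ + 2 * q₁ * r₁ * p₂ ^ 2) * mom s ν d g b 2 1 1
      + (p₁ ^ 2 * q₂ ^ 2 + 4 * p₁ * q₁ * p₂ * q₂ + q₁ ^ 2 * p₂ ^ 2) * mom s ν d g b 2 2 0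
      + (2 * p₁ ^ 2 * p₂ * r₂ + 2 * p₁ * r₁ * p₂ ^ 2) * mom s ν d g b 3 0 1
      + (2 * p₁ ^ 2 * p₂ * q₂ + 2 * p₁ * q₁ * p₂ ^ 2) * mom s ν d g b 3 1 0
      + (p₁ ^ 2 * p₂ ^ 2) * mom s ν d g b 4 0 0 := by
  simp only [mom, affine, Finset.mul_sum, ← Finset.sum_add_distrib]
  refine Finset.sum_congr rfl (fun x _ => ?_)
  ring

/-- PAIRING IDENTITY: against a clean residual measure the biquadratic certificate sees only the Weil charge:
`Σ ν·ℓ₁²ℓ₂² = (P μre + Q μim)/8` with `P − iQ = (q₁ − i r₁)² (q₂ − i r₂)²`. -/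
theorem pairing_identity {s : Finset ι} {ν d g b : ι → ℝ} {μre μim : ℝ} (h : CleanMoments s ν d g b μre μim)
    (α₁ p₁ q₁ r₁ α₂ p₂ q₂ r₂ : ℝ) :
    ∑ x ∈ s, ν x * (affine d g b α₁ p₁ q₁ r₁ x ^ 2 * affine d g b α₂ p₂ q₂ r₂ x ^ 2)
      = (((q₁ ^ 2 - r₁ ^ 2) * (q₂ ^ 2 - r₂ ^ 2) - (2 * q₁ * r₁) * (2 * q₂ * r₂)) * μre
          + ((q₁ ^ 2 - r₁ ^ 2) * (2 * q₂ * r₂) + (q₂ ^ 2 - r₂ ^ 2) * (2 * q₁ * r₁)) * μim) / 8 := by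
  rw [sum_biquadratic_expand, h.m40, h.m31, h.m22, h.m13, h.m04]
  simp only [h.zero 0 0 0 (by norm_num) (by norm_num),
    h.zero 0 0 1 (by norm_num) (by norm_num),
    h.zero 0 1 0 (by norm_num) (by norm_num),
    h.zero 1 0 0 (by norm_num) (by norm_num),
    h.zero 0 0 2 (by norm_num) (by norm_num),
    h.zero 0 1 1 (by norm_num) (by norm_num),
    h.zero 0 2 0 (by norm_num) (by norm_num),
    h.zero 1 0 1 (by norm_num) (by norm_num),
    h.zero 1 1 0 (by norm_num) (by norm_num),
    h.zero 2 0 0 (by norm_num) (by norm_num),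
    h.zero 0 0 3 (by norm_num) (by norm_num),
    h.zero 0 1 2 (by norm_num) (by norm_num),
    h.zero 0 2 1 (by norm_num) (by norm_num),
    h.zero 0 3 0 (by norm_num) (by norm_num),
    h.zero 1 0 2 (by norm_num) (by norm_num),
    h.zero 1 1 1 (by norm_num) (by norm_num),
    h.zero 1 2 0 (by norm_num) (by norm_num),
    h.zero 2 0 1 (by norm_num) (by norm_num),
    h.zero 2 1 0 (by norm_num) (by norm_num),
    h.zero 3 0 0 (by norm_num) (by norm_num),
    h.zero 1 0 3 (by norm_num) (by norm_num),
    h.zero 1 1 2 (by norm_num) (by norm_num),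
    h.zero 1 2 1 (by norm_num) (by norm_num),
    h.zero 1 3 0 (by norm_num) (by norm_num),
    h.zero 2 0 2 (by norm_num) (by norm_num),
    h.zero 2 1 1 (by norm_num) (by norm_num),
    h.zero 2 2 0 (by norm_num) (by norm_num),
    h.zero 3 0 1 (by norm_num) (by norm_num),
    h.zero 3 1 0 (by norm_num) (by norm_num),
    h.zero 4 0 0 (by norm_num) (by norm_num)]
  ring

/-- SIGN LEMMA: if every atom of positive weight is one of x₁..x₄, ℓ₁ vanishes at x₁, x₂ and ℓ₂ at x₃, x₄, then `Σ ν·ℓ₁²ℓ₂² ≤ 0`. -/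
theorem pairing_nonpos (s : Finset ι) (ν d g b : ι → ℝ) {x₁ x₂ x₃ x₄ : ι}
    (hsupp : ∀ x ∈ s, 0 < ν x → (x = x₁ ∨ x = x₂ ∨ x = x₃ ∨ x = x₄))
    {α₁ p₁ q₁ r₁ α₂ p₂ q₂ r₂ : ℝ}
    (h₁ : affine d g b α₁ p₁ q₁ r₁ x₁ = 0) (h₂ : affine d g b α₁ p₁ q₁ r₁ x₂ = 0)
    (h₃ : affine d g b α₂ p₂ q₂ r₂ x₃ = 0) (h₄ : affine d g b α₂ p₂ q₂ r₂ x₄ = 0) :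
    ∑ x ∈ s, ν x * (affine d g b α₁ p₁ q₁ r₁ x ^ 2 * affine d g b α₂ p₂ q₂ r₂ x ^ 2) ≤ 0 := by
  apply Finset.sum_nonpos
  intro x hx
  by_cases hν : 0 < ν x
  · rcases hsupp x hx hν with rfl | rfl | rfl | rfl
    · rw [h₁]; simp
    · rw [h₂]; simp
    · rw [h₃]; simp
    · rw [h₄]; simp
  · have hν' : ν x ≤ 0 := not_lt.mp hν
    have hF : 0 ≤ affine d g b α₁ p₁ q₁ r₁ x ^ 2 * affine d g b α₂ p₂ q₂ r₂ x ^ 2 := by positivity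
    nlinarith [mul_nonneg (neg_nonneg.mpr hν') hF]

/-- a plane through two points on DIFFERENT latitudes may have any prescribed (g,b)-part (q, r). -/
theorem plane_two_latitudes {d₁ d₂ : ℝ} (g₁ b₁ g₂ b₂ : ℝ) (hd : d₁ ≠ d₂) (q r : ℝ) :
    ∃ α p : ℝ, α + p * d₁ + q * g₁ + r * b₁ = 0 ∧ α + p * d₂ + q * g₂ + r * b₂ = 0 := by
  have hd' : d₁ - d₂ ≠ 0 := sub_ne_zero.mpr hd
  refine ⟨-((-(q * (g₁ - g₂) + r * (b₁ - b₂)) / (d₁ - d₂)) * d₁ + q * g₁ + r * b₁),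
    -(q * (g₁ - g₂) + r * (b₁ - b₂)) / (d₁ - d₂), by ring, ?_⟩
  field_simp
  ring

/-- a plane through one point may have any prescribed (g,b)-part (q, r). -/
theorem plane_one_point (d₁ g₁ b₁ q r : ℝ) : ∃ α p : ℝ, α + p * d₁ + q * g₁ + r * b₁ = 0 :=
  ⟨-(q * g₁ + r * b₁), 0, by ring⟩

/-- through ANY two points there is a plane with nonzero (g,b)-part. -/
theorem plane_through_pair (d₃ g₃ b₃ d₄ g₄ b₄ : ℝ) :
    ∃ α p q r : ℝ, 0 < q ^ 2 + r ^ 2 ∧ α + p * d₃ + q * g₃ + r * b₃ = 0 ∧ α + p * d₄ + q * g₄ + r * b₄ = 0 := by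
  by_cases hd : d₃ = d₄
  · by_cases hgb : g₃ = g₄ ∧ b₃ = b₄
    · obtain ⟨hg, hb⟩ := hgb
      exact ⟨-g₃, 0, 1, 0, by norm_num, by ring, by rw [← hg]; ring⟩
    · refine ⟨-(-(b₃ - b₄) * g₃ + (g₃ - g₄) * b₃), 0, -(b₃ - b₄), g₃ - g₄, ?_, by ring, by ring⟩
      rcases not_and_or.mp hgb with hg | hb
      · have : 0 < (g₃ - g₄) ^ 2 := by
          have hne : g₃ - g₄ ≠ 0 := sub_ne_zero.mpr hg
          positivity
        nlinarith [sq_nonneg (b₃ - b₄)]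
      · have : 0 < (b₃ - b₄) ^ 2 := by
          have hne : b₃ - b₄ ≠ 0 := sub_ne_zero.mpr hb
          positivity
        nlinarith [sq_nonneg (g₃ - g₄)]
  · obtain ⟨α, p, h₃, h₄⟩ := plane_two_latitudes g₃ b₃ g₄ b₄ hd 1 0
    exact ⟨α, p, 1, 0, by norm_num, h₃, h₄⟩

/-- HALF-PLANE LEMMA: if `(P μre + Q μim)/8 ≤ 0` for every (q, r), where `P − iQ = (q − i r)²·(A − iB)` and `(A,B) = (Q₀² − R₀², 2Q₀R₀)`,
`(Q₀,R₀) ≠ 0`, then μ = 0 (the products `(q − i r)²(A − iB)` sweep every direction of ℂ). -/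
theorem charge_zero_of_halfplanes {μre μim Q₀ R₀ : ℝ} (hQR : 0 < Q₀ ^ 2 + R₀ ^ 2)
    (h : ∀ q r : ℝ, (((q ^ 2 - r ^ 2) * (Q₀ ^ 2 - R₀ ^ 2) - (2 * q * r) * (2 * Q₀ * R₀)) * μre
          + ((q ^ 2 - r ^ 2) * (2 * Q₀ * R₀) + (Q₀ ^ 2 - R₀ ^ 2) * (2 * q * r)) * μim) / 8 ≤ 0) :
    μre = 0 ∧ μim = 0 := by
  have h1 := h 1 0
  have h2 := h 0 1
  have h3 := h 1 1
  have h4 := h 1 (-1)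
  have E1 : (Q₀ ^ 2 - R₀ ^ 2) * μre + (2 * Q₀ * R₀) * μim = 0 := by nlinarith
  have E2 : -(2 * Q₀ * R₀) * μre + (Q₀ ^ 2 - R₀ ^ 2) * μim = 0 := by nlinarith
  have hsq : (Q₀ ^ 2 - R₀ ^ 2) ^ 2 + (2 * Q₀ * R₀) ^ 2 = (Q₀ ^ 2 + R₀ ^ 2) ^ 2 := by ring
  have hpos : 0 < (Q₀ ^ 2 - R₀ ^ 2) ^ 2 + (2 * Q₀ * R₀) ^ 2 := by rw [hsq]; positivity
  have H1 : ((Q₀ ^ 2 - R₀ ^ 2) ^ 2 + (2 * Q₀ * R₀) ^ 2) * μre = 0 := by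
    linear_combination (Q₀ ^ 2 - R₀ ^ 2) * E1 - (2 * Q₀ * R₀) * E2
  have H2 : ((Q₀ ^ 2 - R₀ ^ 2) ^ 2 + (2 * Q₀ * R₀) ^ 2) * μim = 0 := by
    linear_combination (2 * Q₀ * R₀) * E1 + (Q₀ ^ 2 - R₀ ^ 2) * E2
  exact ⟨(mul_eq_zero.mp H1).resolve_left (ne_of_gt hpos), (mul_eq_zero.mp H2).resolve_left (ne_of_gt hpos)⟩

/-- THEOREM 1 (COCIRCULARITY OF THE RESIDUAL RAYS). If the positive atoms of a clean reduced residual measure are among x₁, x₂, x₃, x₄ and two of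
them lie on different latitudes (`d x₁ ≠ d x₂`), then the Weil charge vanishes. Certificate: ℓ₁²ℓ₂² with ℓ₁ through x₁, x₂ (free (g,b)-part) and
ℓ₂ through x₃, x₄ (fixed nonzero (g,b)-part). -/
theorem weil_charge_zero_of_two_latitudes {s : Finset ι} {ν d g b : ι → ℝ} {μre μim : ℝ}
    (h : CleanMoments s ν d g b μre μim) {x₁ x₂ x₃ x₄ : ι}
    (hsupp : ∀ x ∈ s, 0 < ν x → (x = x₁ ∨ x = x₂ ∨ x = x₃ ∨ x = x₄)) (hd : d x₁ ≠ d x₂) :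
    μre = 0 ∧ μim = 0 := by
  obtain ⟨α₂, p₂, Q₀, R₀, hQR, h₃, h₄⟩ := plane_through_pair (d x₃) (g x₃) (b x₃) (d x₄) (g x₄) (b x₄)
  refine charge_zero_of_halfplanes hQR (fun q r => ?_)
  obtain ⟨α₁, p₁, e₁, e₂⟩ := plane_two_latitudes (g x₁) (b x₁) (g x₂) (b x₂) hd q r
  have key := pairing_nonpos s ν d g b hsupp (α₁ := α₁) (p₁ := p₁) (q₁ := q) (r₁ := r) (α₂ := α₂) (p₂ := p₂) (q₂ := Q₀) (r₂ := R₀)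
    (by rw [affine_apply]; exact e₁) (by rw [affine_apply]; exact e₂) (by rw [affine_apply]; exact h₃) (by rw [affine_apply]; exact h₄)
  rw [pairing_identity h] at key
  exact key

/-- COROLLARY (corank ≤ 3 is never bad): if the positive atoms are among three rays x₁, x₂, x₃ then μ = 0 — in every frame, at every height. -/
theorem weil_charge_zero_of_three_atoms {s : Finset ι} {ν d g b : ι → ℝ} {μre μim : ℝ}
    (h : CleanMoments s ν d g b μre μim) {x₁ x₂ x₃ : ι}
    (hsupp : ∀ x ∈ s, 0 < ν x → (x = x₁ ∨ x = x₂ ∨ x = x₃)) : μre = 0 ∧ μim = 0 := by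
  -- ℓ₁ through x₁, x₂ with a fixed nonzero (g,b)-part; ℓ₂ through x₃ alone with free (g,b)-part
  obtain ⟨α₁, p₁, Q₀, R₀, hQR, e₁, e₂⟩ := plane_through_pair (d x₁) (g x₁) (b x₁) (d x₂) (g x₂) (b x₂)
  have hsupp' : ∀ x ∈ s, 0 < ν x → (x = x₁ ∨ x = x₂ ∨ x = x₃ ∨ x = x₃) := fun x hx hν => by
    rcases hsupp x hx hν with hh | hh | hh
    · exact Or.inl hh
    · exact Or.inr (Or.inl hh)
    · exact Or.inr (Or.inr (Or.inl hh))
  refine charge_zero_of_halfplanes hQR (fun q r => ?_)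
  obtain ⟨α₂, p₂, e₃⟩ := plane_one_point (d x₃) (g x₃) (b x₃) q r
  have key := pairing_nonpos s ν d g b hsupp' (α₁ := α₁) (p₁ := p₁) (q₁ := Q₀) (r₁ := R₀) (α₂ := α₂) (p₂ := p₂) (q₂ := q) (r₂ := r)
    (by rw [affine_apply]; exact e₁) (by rw [affine_apply]; exact e₂) (by rw [affine_apply]; exact e₃) (by rw [affine_apply]; exact e₃)
  rw [pairing_identity h] at key
  have : (((q ^ 2 - r ^ 2) * (Q₀ ^ 2 - R₀ ^ 2) - (2 * q * r) * (2 * Q₀ * R₀)) * μre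
          + ((q ^ 2 - r ^ 2) * (2 * Q₀ * R₀) + (Q₀ ^ 2 - R₀ ^ 2) * (2 * q * r)) * μim) / 8
      = (((Q₀ ^ 2 - R₀ ^ 2) * (q ^ 2 - r ^ 2) - (2 * Q₀ * R₀) * (2 * q * r)) * μre
          + ((Q₀ ^ 2 - R₀ ^ 2) * (2 * q * r) + (q ^ 2 - r ^ 2) * (2 * Q₀ * R₀)) * μim) / 8 := by ring
  rw [this]
  exact key

/-- μ ≠ 0 forces the four residual rays onto ONE latitude circle `d = d x₁`. -/
theorem cocircular_of_charge_ne_zero {s : Finset ι} {ν d g b : ι → ℝ} {μre μim : ℝ}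
    (h : CleanMoments s ν d g b μre μim) {x₁ x₂ x₃ x₄ : ι}
    (hsupp : ∀ x ∈ s, 0 < ν x → (x = x₁ ∨ x = x₂ ∨ x = x₃ ∨ x = x₄)) (hμ : ¬ (μre = 0 ∧ μim = 0)) :
    d x₂ = d x₁ ∧ d x₃ = d x₁ ∧ d x₄ = d x₁ := by
  refine ⟨?_, ?_, ?_⟩
  · by_contra hne
    exact hμ (weil_charge_zero_of_two_latitudes h hsupp (Ne.symm hne))
  · by_contra hne
    have hsupp' : ∀ x ∈ s, 0 < ν x → (x = x₃ ∨ x = x₁ ∨ x = x₂ ∨ x = x₄) := fun x hx hν => by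
      rcases hsupp x hx hν with hh | hh | hh | hh
      · exact Or.inr (Or.inl hh)
      · exact Or.inr (Or.inr (Or.inl hh))
      · exact Or.inl hh
      · exact Or.inr (Or.inr (Or.inr hh))
    exact hμ (weil_charge_zero_of_two_latitudes h hsupp' hne)
  · by_contra hne
    have hsupp' : ∀ x ∈ s, 0 < ν x → (x = x₄ ∨ x = x₁ ∨ x = x₂ ∨ x = x₃) := fun x hx hν => by
      rcases hsupp x hx hν with hh | hh | hh | hh
      · exact Or.inr (Or.inl hh)
      · exact Or.inr (Or.inr (Or.inl hh))
      · exact Or.inr (Or.inr (Or.inr hh))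
      · exact Or.inl hh
    exact hμ (weil_charge_zero_of_two_latitudes h hsupp' hne)

/-- THEOREM 2 (CIRCLE CONFINEMENT OF THE NEGATIVE SUPPORT). If every positive atom has latitude `a` then so does every negative atom:
certificate (d − a)² (only the three moments E[1] = E[d] = E[d²] = 0 are used). -/
theorem negative_support_on_circle {s : Finset ι} {ν d g b : ι → ℝ} {μre μim : ℝ}
    (h : CleanMoments s ν d g b μre μim) (a : ℝ) (hpos : ∀ x ∈ s, 0 < ν x → d x = a) :
    ∀ x ∈ s, ν x < 0 → d x = a := by
  have h0 := h.zero 0 0 0 (by norm_num) (by norm_num)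
  have h1 := h.zero 1 0 0 (by norm_num) (by norm_num)
  have h2 := h.zero 2 0 0 (by norm_num) (by norm_num)
  have hS : ∑ x ∈ s, ν x * (d x - a) ^ 2 = mom s ν d g b 2 0 0 - 2 * a * mom s ν d g b 1 0 0 + a ^ 2 * mom s ν d g b 0 0 0 := by
    simp only [mom, Finset.mul_sum, ← Finset.sum_sub_distrib, ← Finset.sum_add_distrib]
    refine Finset.sum_congr rfl (fun x _ => ?_)
    ring
  rw [h0, h1, h2] at hS
  have hS0 : ∑ x ∈ s, ν x * (d x - a) ^ 2 = 0 := by rw [hS]; ring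
  have hle : ∀ x ∈ s, ν x * (d x - a) ^ 2 ≤ 0 := by
    intro x hx
    by_cases hν : 0 < ν x
    · rw [hpos x hx hν]; simp
    · have hν' : ν x ≤ 0 := not_lt.mp hν
      nlinarith [mul_nonneg (neg_nonneg.mpr hν') (sq_nonneg (d x - a))]
  have hall := (Finset.sum_eq_zero_iff_of_nonpos hle).mp hS0
  intro x hx hν
  have hx0 := hall x hx
  have hsq : (d x - a) ^ 2 = 0 := by
    rcases mul_eq_zero.mp hx0 with h' | h'
    · exact absurd h' (ne_of_lt hν)
    · exact h'
  exact sub_eq_zero.mp (pow_eq_zero_iff (two_ne_zero) |>.mp hsq)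

/-- BOTH TOGETHER: a bad reduced residual measure (clean, μ ≠ 0, positive atoms among x₁..x₄) lives on the single latitude circle `d = d x₁`:
all four residual rays and every ray of negative weight. (The octagon count on that circle is the memo's Theorem 3, pen.) -/
theorem bad_measure_lives_on_one_circle {s : Finset ι} {ν d g b : ι → ℝ} {μre μim : ℝ}
    (h : CleanMoments s ν d g b μre μim) {x₁ x₂ x₃ x₄ : ι}
    (hsupp : ∀ x ∈ s, 0 < ν x → (x = x₁ ∨ x = x₂ ∨ x = x₃ ∨ x = x₄)) (hμ : ¬ (μre = 0 ∧ μim = 0)) :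
    (d x₂ = d x₁ ∧ d x₃ = d x₁ ∧ d x₄ = d x₁) ∧ ∀ x ∈ s, ν x ≠ 0 → d x = d x₁ := by
  have hc := cocircular_of_charge_ne_zero h hsupp hμ
  refine ⟨hc, fun x hx hν => ?_⟩
  have hposlat : ∀ y ∈ s, 0 < ν y → d y = d x₁ := fun y hy hνy => by
    rcases hsupp y hy hνy with rfl | rfl | rfl | rfl
    · rfl
    · exact hc.1
    · exact hc.2.1
    · exact hc.2.2
  rcases lt_or_gt_of_ne hν with hlt | hgt
  · exact negative_support_on_circle h (d x₁) hposlat x hx hlt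
  · exact hposlat x hx hgt

/-- δ-FRAME VERSION of THEOREMS 1+2 (g8's conventions, any δ > 0 — ℚ(i): δ = 1; ℚ(ω)-type: δ = 3; RK_m: δ = m): a bad reduced residual measure
lives on one latitude circle `p_d = p_d(x₁)`. -/
theorem bad_measure_lives_on_one_circle_delta {s : Finset ι} {ν d g b : ι → ℝ} {δ μre μim : ℝ} (hδ : 0 < δ)
    (h : CleanMomentsDelta s ν d g b δ μre μim) {x₁ x₂ x₃ x₄ : ι}
    (hsupp : ∀ x ∈ s, 0 < ν x → (x = x₁ ∨ x = x₂ ∨ x = x₃ ∨ x = x₄)) (hμ : ¬ (μre = 0 ∧ μim = 0)) :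
    (d x₂ = d x₁ ∧ d x₃ = d x₁ ∧ d x₄ = d x₁) ∧ ∀ x ∈ s, ν x ≠ 0 → d x = d x₁ := by
  have h' := cleanMoments_of_delta hδ h
  have hs : Real.sqrt δ ≠ 0 := ne_of_gt (Real.sqrt_pos.mpr hδ)
  have hμ' : ¬ (μre = 0 ∧ Real.sqrt δ * μim = 0) := fun hh => hμ ⟨hh.1, (mul_eq_zero.mp hh.2).resolve_left hs⟩
  exact bad_measure_lives_on_one_circle h' hsupp hμ'

/-- δ-FRAME VERSION of the corank ≤ 3 corollary. -/
theorem weil_charge_zero_of_three_atoms_delta {s : Finset ι} {ν d g b : ι → ℝ} {δ μre μim : ℝ} (hδ : 0 < δ)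
    (h : CleanMomentsDelta s ν d g b δ μre μim) {x₁ x₂ x₃ : ι}
    (hsupp : ∀ x ∈ s, 0 < ν x → (x = x₁ ∨ x = x₂ ∨ x = x₃)) : μre = 0 ∧ μim = 0 := by
  have h' := cleanMoments_of_delta hδ h
  have hs : Real.sqrt δ ≠ 0 := ne_of_gt (Real.sqrt_pos.mpr hδ)
  obtain ⟨hre, him⟩ := weil_charge_zero_of_three_atoms h' hsupp
  exact ⟨hre, (mul_eq_zero.mp him).resolve_left hs⟩

/-- δ-FRAME VERSION of THEOREM 1 with an explicit pair of residual rays on different latitudes. -/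
theorem weil_charge_zero_of_two_latitudes_delta {s : Finset ι} {ν d g b : ι → ℝ} {δ μre μim : ℝ} (hδ : 0 < δ)
    (h : CleanMomentsDelta s ν d g b δ μre μim) {x₁ x₂ x₃ x₄ : ι}
    (hsupp : ∀ x ∈ s, 0 < ν x → (x = x₁ ∨ x = x₂ ∨ x = x₃ ∨ x = x₄)) (hd : d x₁ ≠ d x₂) :
    μre = 0 ∧ μim = 0 := by
  have h' := cleanMoments_of_delta hδ h
  have hs : Real.sqrt δ ≠ 0 := ne_of_gt (Real.sqrt_pos.mpr hδ)
  obtain ⟨hre, him⟩ := weil_charge_zero_of_two_latitudes h' hsupp hd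
  exact ⟨hre, (mul_eq_zero.mp him).resolve_left hs⟩

end Summit.HodgeConjecture.HodgeConjecture.Cruxes.BlochSeedDiscOne.CelestialCocircularity
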